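import Literature.MathematicalPhysics.QuantumFieldTheory.Balaban1983to89.B9SectBCodedClassGY
import Literature.MathematicalPhysics.QuantumFieldTheory.Balaban1983to89.B9SectBCodedChainOnSubfamily

/-!
# `Balaban1983to89.B9SectBCodedChainC37GY` — the coded-carrier chain of Sect. B's step for `G′` on a subfamily, WITH THE CLASS HYPOTHESES
# DISCHARGED for the EXTENDED coded class `C37GY` (NODE 00's symmetric transporter `parSymY`; the `C37GY` twin of g8's `B9SectBCodedChainC37Y`,
# so that the G-side laws `hC37G`, `hvarB` of gen 13's `gFrame₅CodedOn` are projections of the chain's own class — seat dag-n06-c gen 15)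

T. Bałaban, *Propagators for lattice gauge theories in a background field*, Commun. Math. Phys. **99** (1985) 389–434
[`Balaban1985BackgroundPropagators`, "B9"], Theorem 3.4 p. 400, Sect. B pp. 400–407, (3.35)–(3.37) p. 396, (3.58) p. 402, p. 403 l. 1–9;
T. Bałaban, *Propagators and renormalization transformations for lattice gauge theories. II*, Commun. Math. Phys. **96** (1984) 223–250
[`Balaban1984PropagatorsII`, "[4]"], (2.45) p. 231, Lemma 2.1 p. 234.

statement-level skeleton of published theorems with citation tags; proofs where landed; nothing here is a claim about the Yang–Mills mass gap

WHY THIS FILE (pub-ymgap N06 row 13, seat dag-n06-c gen 15; verbatim twin of gen 8's `B9SectBCodedChainC37Y` with `C37Y ↦ C37GY`).  `B9SectBCodedChainOnSubfamily.sectBStepPrinted_on_of_KSC` composes the chain on a subfamily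
`f : J → MemberY …` under two class hypotheses displayed in generic form: `hC37` (the coded class implies «`U` `G`-valued and `CplxLettersY`») and `hclass` (the
record's (3.37) at `α₁ ≦ αcap` implies the coded class at `r·α₁`).  For the extended coded class `C37GY G x ιB Cq := C37Y … ∧ CplxLettersGY … ∧ VarParBY parBY (cVarGY d ℓ) …` of
`B9SectBCodedClassGY` both are THEOREMS (`hC37_of_C37GY` by projection; `hclass_C37GY_at` = the (3.37) → letters dictionary with the (3.58) estimate, `r = L⁴`,
`αcap = 1∕4`, threshold `2(d+1)+1 ≦ M`, `Cq = 4(d+1)e^{3(d+1)/2}`).  This file plugs them in: what remains displayed is exactly (i) the Sect.-B step for the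
augmented coded readings `KSC` on the subfamily (the letters-level frames' output), (ii) the analyticity transport `hAn` (the instance's pin), (iii) structural
record data (`hG1`, a real basis `b` with coordinate constant `M₂`, nonnegative Hölder members of `GA`, the complex class `C38` of the `(3.38)`-side coding).

WHAT IS IN THE FILE (0 sorry; standard axioms; no definitions).
* (§1 of the twin, `hclass_C37GY_on`, lives in `B9SectBCodedClassGY`.)
* §2 ★★★ `sectBStepPrinted_on_of_KSC_C37GY f` — the chain on a subfamily with sections `ιB j`, class hypotheses discharged.
* §3 ★★★ `sectBStepPrinted_cornerFree_of_KSC_C37GY f hf` — the same on a corner-free subfamily with the canonical sections `Function.surjInv (hf j)`: NO section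
  binder, NO class hypothesis.

HONEST SCOPE.  Composition of landed theorems; the displayed hypotheses (i)–(iii) above are not discharged here ((i) = the frames over the coded carrier beyond
the root frame; (ii) = the record's `IsAnalyticExt` pin).  Nothing of Theorem 3.1∕3.4 is asserted; N06 NOT discharged; COUNT-NEUTRAL; one finite lattice
programme — nothing continuum ∕ OS ∕ mass-gap ∕ Clay.  Cell `pub-ymgap` (HUMAN RULING D-0062), Track A node N06 [B9], row 13, 2026-08-29; `--supports stmt-QuantumFields-27364`.
-/

namespace Literature.MathematicalPhysics.QuantumFieldTheory.Balaban1983to89.B9SectBCodedChainC37GY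

open Literature.MathematicalPhysics.QuantumFieldTheory.Balaban1983to89
open Literature.MathematicalPhysics.QuantumFieldTheory.Balaban1983to89.B6KLevelCensusIndexV1 (KIdx kGeo)
open Literature.MathematicalPhysics.QuantumFieldTheory.Balaban1983to89.B6Ineq2142KLevelV1 (β)
open Literature.MathematicalPhysics.QuantumFieldTheory.Balaban1983to89.B9SectBCodedCarrier (CCfg Coding pullK pullS pullAn)
open Literature.MathematicalPhysics.QuantumFieldTheory.Balaban1983to89.B9Eq360DeltaPrimeAY (AfldY mulY)
open Literature.MathematicalPhysics.QuantumFieldTheory.Balaban1983to89.B9PinMembersKLevelV1 (MemberY geo9Y bg9Y)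
open Literature.MathematicalPhysics.QuantumFieldTheory.Balaban1983to89.B9SectBGpLettersY (GVal)
open Literature.MathematicalPhysics.QuantumFieldTheory.Balaban1983to89.B9SectBGpFrameCodedY (codingYx CplxLettersY)
open Literature.MathematicalPhysics.QuantumFieldTheory.Balaban1983to89.B9SectBGpReadingsY (KSC)
open Literature.MathematicalPhysics.QuantumFieldTheory.Balaban1983to89.B9SectBCodedClassGY (C37GY hclass_C37GY_at hclass_C37GY_on hC37_of_C37GY)
open Literature.MathematicalPhysics.QuantumFieldTheory.Balaban1983to89.B9SectBCodedChainOnSubfamily (sectBStepPrinted_on_of_KSC)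
open Literature.MathematicalPhysics.QuantumFieldTheory.Balaban1983to89.Node00 (SiteY BlkY IBondY CfgY SiteParY parSymY kernelFamilyS GpY)

variable {d ℓ : ℕ} {hd : 1 ≤ d + 1} {hL : Odd (ℓ + 1) ∧ 1 < ℓ + 1} {b₀ b₁ : ℝ} {Mstar : ℕ}
variable {𝔸 : Type} [NormedRing 𝔸] [NormedAlgebra ℂ 𝔸] [CompleteSpace 𝔸] [NormOneClass 𝔸] [FiniteDimensional ℝ 𝔸]
variable {J : Type} (f : J → MemberY d ℓ hd hL b₀ b₁ Mstar) [∀ x : MemberY d ℓ hd hL b₀ b₁ Mstar, Fintype (geo9Y x).Site]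
  (G : Subgroup 𝔸ˣ) {ι : Type} [Fintype ι] (b : Module.Basis ι ℝ 𝔸)
  (ιB : ∀ j : J, BlkY (f j).toKIdx → IBondY (f j).toKIdx)
  (C38 : ∀ j : J, ℝ → CfgY 𝔸 (f j).toKIdx → AfldY 𝔸 (f j).toKIdx → Prop)

/-! ## §2 ★★★ The chain on a subfamily, class hypotheses discharged -/

/-- ★★★ **THE CODED-CARRIER CHAIN ON A SUBFAMILY WITH SECTIONS, CLASS HYPOTHESES DISCHARGED** (extended coded class `C37GY`, transporter `parSymY`, `Cq = 4(d+1)e^{3(d+1)/2}`,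
`r = L⁴`, `αcap = 1∕4`, `Mc = 2(d+1)+1`): IF the Sect.-B step holds for the augmented coded readings `(KSC, pullK GA, pullS Cinv, IsAnK)` over the coded carriers
on `J`, and the analyticity predicates transport (`hAn`), THEN the Sect.-B step holds for the record's families — `G′` read by `kernelFamilyS (GpY parSymY) parSymY`,
`GA`, `Cinv`, `IsAn` over `bg9Y` — on `J`. [cite: Balaban1985BackgroundPropagators, Thm 3.4 p.400, Sect. B pp.400–407, p.403 l.1–9, (3.35)–(3.37) p.396, (3.58) p.402, p.399 (the family); Balaban1984PropagatorsII, Lemma 2.1 p.234] -/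
theorem sectBStepPrinted_on_of_KSC_C37GY (hι : ∀ (j : J) (s : BlkY (f j).toKIdx), β (f j).toKIdx.hN (f j).toKIdx.D (f j).toKIdx.hk (ιB j s) = s)
    (hG1 : ∀ u : 𝔸ˣ, u ∈ G → ‖(u : 𝔸)‖ ≤ 1) {M₂ : ℝ} (hM₂ : 0 ≤ M₂) (hrepr : ∀ (v : 𝔸) (j : ι), |b.repr v j| ≤ M₂ * ‖v‖) (c35 : ℝ) (dC : ℕ)
    (GA : ∀ j : J, B9.KernelFamily (geo9Y (f j)) (bg9Y 𝔸 G (f j))) (Cinv : ∀ j : J, B9.SiteKernel (geo9Y (f j)) (bg9Y 𝔸 G (f j)))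
    (hGA : ∀ (j : J) (U : (bg9Y 𝔸 G (f j)).Cfg),
      (∀ lam β' ζ, 0 ≤ (GA j).h1 U lam β' ζ) ∧ (∀ lam y, 0 ≤ (GA j).e4 U lam y) ∧ (∀ lam β' ζ, 0 ≤ (GA j).h2 U lam β' ζ))
    (IsAnK : ∀ j : J,
      B9.KernelFamily (geo9Y (f j)) (codingYx G (f j) (C37GY G (f j) (ιB j) (4 * ((d : ℝ) + 1) * Real.exp (3 * (((d : ℝ) + 1) / 2)))) (C38 j)).bg →
        (codingYx G (f j) (C37GY G (f j) (ιB j) (4 * ((d : ℝ) + 1) * Real.exp (3 * (((d : ℝ) + 1) / 2)))) (C38 j)).bg.Cfg → ℝ → Prop)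
    (IsAn : ∀ j : J, B9.KernelFamily (geo9Y (f j)) (bg9Y 𝔸 G (f j)) → (bg9Y 𝔸 G (f j)).Cfg → ℝ → Prop) {ac : ℝ} (hac : 0 < ac)
    (hAn : ∀ (j : J) (c : (codingYx G (f j) (C37GY G (f j) (ιB j) (4 * ((d : ℝ) + 1) * Real.exp (3 * (((d : ℝ) + 1) / 2)))) (C38 j)).bg.Cfg) (α : ℝ),
      (IsAnK j (KSC G (f j) (parSymY (f j).toKIdx) (C37GY G (f j) (ιB j) (4 * ((d : ℝ) + 1) * Real.exp (3 * (((d : ℝ) + 1) / 2)))) (C38 j)) c α →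
        pullAn (codingYx G (f j) (C37GY G (f j) (ιB j) (4 * ((d : ℝ) + 1) * Real.exp (3 * (((d : ℝ) + 1) / 2)))) (C38 j)) (((ℓ : ℝ) + 1) ^ 4) (IsAn j)
          (pullK (codingYx G (f j) (C37GY G (f j) (ιB j) (4 * ((d : ℝ) + 1) * Real.exp (3 * (((d : ℝ) + 1) / 2)))) (C38 j))
            (kernelFamilyS (f j).toKIdx (bg9Y 𝔸 G (f j)) (fun U => U) (GpY (f j).toKIdx (parSymY (f j).toKIdx)) (parSymY (f j).toKIdx))) c α) ∧
      (IsAnK j (pullK (codingYx G (f j) (C37GY G (f j) (ιB j) (4 * ((d : ℝ) + 1) * Real.exp (3 * (((d : ℝ) + 1) / 2)))) (C38 j)) (GA j)) c α →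
        pullAn (codingYx G (f j) (C37GY G (f j) (ιB j) (4 * ((d : ℝ) + 1) * Real.exp (3 * (((d : ℝ) + 1) / 2)))) (C38 j)) (((ℓ : ℝ) + 1) ^ 4) (IsAn j)
          (pullK (codingYx G (f j) (C37GY G (f j) (ιB j) (4 * ((d : ℝ) + 1) * Real.exp (3 * (((d : ℝ) + 1) / 2)))) (C38 j)) (GA j)) c α))
    (h : B9.SectBStepPrinted dC c35 (fun j => geo9Y (f j))
      (fun j => (codingYx G (f j) (C37GY G (f j) (ιB j) (4 * ((d : ℝ) + 1) * Real.exp (3 * (((d : ℝ) + 1) / 2)))) (C38 j)).bg)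
      (fun j => KSC G (f j) (parSymY (f j).toKIdx) (C37GY G (f j) (ιB j) (4 * ((d : ℝ) + 1) * Real.exp (3 * (((d : ℝ) + 1) / 2)))) (C38 j))
      (fun j => pullK (codingYx G (f j) (C37GY G (f j) (ιB j) (4 * ((d : ℝ) + 1) * Real.exp (3 * (((d : ℝ) + 1) / 2)))) (C38 j)) (GA j))
      (fun j => pullS (codingYx G (f j) (C37GY G (f j) (ιB j) (4 * ((d : ℝ) + 1) * Real.exp (3 * (((d : ℝ) + 1) / 2)))) (C38 j)) (Cinv j)) IsAnK) :
    B9.SectBStepPrinted dC c35 (fun j => geo9Y (f j)) (fun j => bg9Y 𝔸 G (f j))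
      (fun j => kernelFamilyS (f j).toKIdx (bg9Y 𝔸 G (f j)) (fun U => U) (GpY (f j).toKIdx (parSymY (f j).toKIdx)) (parSymY (f j).toKIdx)) GA Cinv IsAn := by
  have hL4 : (0 : ℝ) < ((ℓ : ℝ) + 1) ^ 4 := by positivity
  exact sectBStepPrinted_on_of_KSC f G (fun j => parSymY (f j).toKIdx) b ιB
    (fun j => C37GY G (f j) (ιB j) (4 * ((d : ℝ) + 1) * Real.exp (3 * (((d : ℝ) + 1) / 2)))) C38 hG1 hM₂ hrepr hι
    (fun j => hC37_of_C37GY G (f j) (ιB j) _) c35 dC GA Cinv hGA IsAnK IsAn hL4 (by norm_num : (0 : ℝ) < 1 / 4) hac hAn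
    (hclass_C37GY_on f G ιB C38 hι hG1 c35 ac) h

/-! ## §3 ★★★ The chain on a corner-free subfamily: no section binder, no class hypothesis -/

/-- ★★★ **THE CODED-CARRIER CHAIN ON A CORNER-FREE SUBFAMILY** (`hf : β` onto at every `f j`; sections `Function.surjInv (hf j)`; extended coded class `C37GY`): the Sect.-B
step for the augmented coded readings over the members `f j` gives the Sect.-B step for the record's families over them — the displayed hypotheses are the
frames' output `h`, the analyticity transport `hAn`, and structural record data only. [cite: Balaban1985BackgroundPropagators, Thm 3.4 p.400, Sect. B pp.400–407, p.403 l.1–9, (3.35)–(3.37) p.396, (3.58) p.402, p.399; Balaban1984PropagatorsII, (2.45) p.231, Lemma 2.1 p.234] -/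
theorem sectBStepPrinted_cornerFree_of_KSC_C37GY (hf : ∀ j : J, Function.Surjective (β (f j).toKIdx.hN (f j).toKIdx.D (f j).toKIdx.hk))
    (hG1 : ∀ u : 𝔸ˣ, u ∈ G → ‖(u : 𝔸)‖ ≤ 1) {M₂ : ℝ} (hM₂ : 0 ≤ M₂) (hrepr : ∀ (v : 𝔸) (j : ι), |b.repr v j| ≤ M₂ * ‖v‖) (c35 : ℝ) (dC : ℕ)
    (GA : ∀ j : J, B9.KernelFamily (geo9Y (f j)) (bg9Y 𝔸 G (f j))) (Cinv : ∀ j : J, B9.SiteKernel (geo9Y (f j)) (bg9Y 𝔸 G (f j)))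
    (hGA : ∀ (j : J) (U : (bg9Y 𝔸 G (f j)).Cfg),
      (∀ lam β' ζ, 0 ≤ (GA j).h1 U lam β' ζ) ∧ (∀ lam y, 0 ≤ (GA j).e4 U lam y) ∧ (∀ lam β' ζ, 0 ≤ (GA j).h2 U lam β' ζ))
    (IsAnK : ∀ j : J,
      B9.KernelFamily (geo9Y (f j))
          (codingYx G (f j) (C37GY G (f j) (fun s => Function.surjInv (hf j) s) (4 * ((d : ℝ) + 1) * Real.exp (3 * (((d : ℝ) + 1) / 2)))) (C38 j)).bg →
        (codingYx G (f j) (C37GY G (f j) (fun s => Function.surjInv (hf j) s) (4 * ((d : ℝ) + 1) * Real.exp (3 * (((d : ℝ) + 1) / 2)))) (C38 j)).bg.Cfg →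
          ℝ → Prop)
    (IsAn : ∀ j : J, B9.KernelFamily (geo9Y (f j)) (bg9Y 𝔸 G (f j)) → (bg9Y 𝔸 G (f j)).Cfg → ℝ → Prop) {ac : ℝ} (hac : 0 < ac)
    (hAn : ∀ (j : J)
      (c : (codingYx G (f j) (C37GY G (f j) (fun s => Function.surjInv (hf j) s) (4 * ((d : ℝ) + 1) * Real.exp (3 * (((d : ℝ) + 1) / 2)))) (C38 j)).bg.Cfg)
      (α : ℝ),
      (IsAnK j (KSC G (f j) (parSymY (f j).toKIdx)
          (C37GY G (f j) (fun s => Function.surjInv (hf j) s) (4 * ((d : ℝ) + 1) * Real.exp (3 * (((d : ℝ) + 1) / 2)))) (C38 j)) c α →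
        pullAn (codingYx G (f j) (C37GY G (f j) (fun s => Function.surjInv (hf j) s) (4 * ((d : ℝ) + 1) * Real.exp (3 * (((d : ℝ) + 1) / 2)))) (C38 j))
          (((ℓ : ℝ) + 1) ^ 4) (IsAn j)
          (pullK (codingYx G (f j) (C37GY G (f j) (fun s => Function.surjInv (hf j) s) (4 * ((d : ℝ) + 1) * Real.exp (3 * (((d : ℝ) + 1) / 2)))) (C38 j))
            (kernelFamilyS (f j).toKIdx (bg9Y 𝔸 G (f j)) (fun U => U) (GpY (f j).toKIdx (parSymY (f j).toKIdx)) (parSymY (f j).toKIdx))) c α) ∧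
      (IsAnK j (pullK (codingYx G (f j) (C37GY G (f j) (fun s => Function.surjInv (hf j) s) (4 * ((d : ℝ) + 1) * Real.exp (3 * (((d : ℝ) + 1) / 2))))
          (C38 j)) (GA j)) c α →
        pullAn (codingYx G (f j) (C37GY G (f j) (fun s => Function.surjInv (hf j) s) (4 * ((d : ℝ) + 1) * Real.exp (3 * (((d : ℝ) + 1) / 2)))) (C38 j))
          (((ℓ : ℝ) + 1) ^ 4) (IsAn j)
          (pullK (codingYx G (f j) (C37GY G (f j) (fun s => Function.surjInv (hf j) s) (4 * ((d : ℝ) + 1) * Real.exp (3 * (((d : ℝ) + 1) / 2)))) (C38 j))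
            (GA j)) c α))
    (h : B9.SectBStepPrinted dC c35 (fun j => geo9Y (f j))
      (fun j => (codingYx G (f j) (C37GY G (f j) (fun s => Function.surjInv (hf j) s) (4 * ((d : ℝ) + 1) * Real.exp (3 * (((d : ℝ) + 1) / 2)))) (C38 j)).bg)
      (fun j => KSC G (f j) (parSymY (f j).toKIdx)
        (C37GY G (f j) (fun s => Function.surjInv (hf j) s) (4 * ((d : ℝ) + 1) * Real.exp (3 * (((d : ℝ) + 1) / 2)))) (C38 j))
      (fun j => pullK (codingYx G (f j) (C37GY G (f j) (fun s => Function.surjInv (hf j) s) (4 * ((d : ℝ) + 1) * Real.exp (3 * (((d : ℝ) + 1) / 2))))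
        (C38 j)) (GA j))
      (fun j => pullS (codingYx G (f j) (C37GY G (f j) (fun s => Function.surjInv (hf j) s) (4 * ((d : ℝ) + 1) * Real.exp (3 * (((d : ℝ) + 1) / 2))))
        (C38 j)) (Cinv j)) IsAnK) :
    B9.SectBStepPrinted dC c35 (fun j => geo9Y (f j)) (fun j => bg9Y 𝔸 G (f j))
      (fun j => kernelFamilyS (f j).toKIdx (bg9Y 𝔸 G (f j)) (fun U => U) (GpY (f j).toKIdx (parSymY (f j).toKIdx)) (parSymY (f j).toKIdx)) GA Cinv IsAn :=
  sectBStepPrinted_on_of_KSC_C37GY f G b (fun j s => Function.surjInv (hf j) s) C38 (fun j s => Function.surjInv_eq (hf j) s) hG1 hM₂ hrepr c35 dC GA Cinv hGA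
    IsAnK IsAn hac hAn h

end Literature.MathematicalPhysics.QuantumFieldTheory.Balaban1983to89.B9SectBCodedChainC37GY
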